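import Literature.NumberTheory.EllipticCurves.LocalTorsionMultiplicativeProofs
import Literature.NumberTheory.EllipticCurves.GoodReductionTorsionReductionProofs
import Literature.NumberTheory.EllipticCurves.MazurTorsionOrderValuationProofs
import HarnessLib

/-!
# A point of prime order `p` forces `ℓ ≡ −1 (mod p)` at a NON-split and `ℓ ≡ 1 (mod p)` at a split
# multiplicative prime `ℓ ≠ p` with `p ∤ v_ℓ(Δ_min)` (Silverman, *AEC* VII.2.1, VII.3.1, VII.6.1, Ex. 3.5)

Source: J. H. Silverman, *The Arithmetic of Elliptic Curves*, 2nd ed., GTM 106 (2009)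
[SilvermanAEC2009]: Prop. VII.2.1 (`E₀(K)/E₁(K) ≅ Ẽ_ns(k)`), Prop. VII.3.1 (`E₁(K)` has no torsion
of order prime to the residue characteristic — here `p ≠ ℓ`), Thm. VII.6.1 (Kodaira–Néron:
`c_ℓ = ord_ℓ(Δ_min)` for split, `c_ℓ ∈ {1, 2}` for non-split multiplicative reduction;
*ATAEC* IV.9.4 Step 2 [SilvermanATAEC1994]), Exercise 3.5 (`#Ẽ_ns(𝔽_ℓ) = ℓ − 1` for a split node,
`ℓ + 1` for a non-split node).

THE THEOREMS KERNEL-CHECKED HERE (theorems only, 0 definitions, 0 named facts). For `W/ℚ` elliptic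
and globally minimal, a prime `ℓ` of multiplicative reduction, a prime `p ≠ ℓ`, and a point
`P ∈ W(ℚ_ℓ)` (in particular a rational point) with `p • P = O`, `P ≠ O`:
* `dvd_localTamagawaNumber_mul_reductionPointCount_of_nsmul_eq_zero` — `p ∣ c_ℓ · #Ẽ_ns(𝔽_ℓ)`
  (any reduction type: `m • P ∈ E₁(ℚ_ℓ)` for `m = [E(ℚ_ℓ) : E₁(ℚ_ℓ)] = c_ℓ · #Ẽ_ns(𝔽_ℓ)`,
  `index_formalFiltration`; `E₁(ℚ_ℓ)` has no `p`-torsion for `p ≠ ℓ`,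
  `eq_zero_of_nsmul_eq_zero_of_isInReductionKernel`; so `m • P = O` and `p = ord P ∣ m`);
* `dvd_succ_of_nonsplit` — NON-split at `ℓ`, `p ≠ 2`: `p ∣ ℓ + 1` (`c_ℓ ∈ {1, 2}`, `#Ẽ_ns = ℓ + 1`);
* `dvd_pred_of_split` — SPLIT at `ℓ` with `p ∤ v_ℓ(Δ_min)`: `p ∣ ℓ − 1` (`c_ℓ = v_ℓ(Δ_min)`,
  `#Ẽ_ns = ℓ − 1`);
* the same from a RATIONAL point of order `p` (`…_of_rat`, via the injection `W(ℚ) ↪ W(ℚ_ℓ)`) and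
  from `p ∣ #W(ℚ)_tors` (`…_of_dvd_torsionOrder`, Cauchy), with the `ZMod p` spellings
  `cast_eq_neg_one_of_nonsplit_of_dvd_torsionOrder : (ℓ : ZMod p) = −1` and
  `cast_eq_one_of_split_of_dvd_torsionOrder : (ℓ : ZMod p) = 1`.

Consumer (why this port exists): the Eisenstein-prime programme of the BSD cell (route
`EisensteinPrimes`, line `mudescent`, cruxes 3/5; HOME/bsd-eis/lam-a-g11/lam-a-MEMO-11.md §3b local
analysis (i′), HOME/lam-a-g12): on a type-A étale end (a curve with a rational point of odd prime
order `p` and squarefree conductor) every non-split multiplicative prime `ℓ ≠ p` is `≡ −1 (mod p)`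
— so the level-raising factor `1 − ℓ⁻¹γ_ℓ` of the `ε_ℓ = +1` stabilisation is a UNIT mod `p`
(`isUnit_one_add_frobeniusSeries`), the bookkeeping behind THEOREMS C^mix / C^oth / the C^rel
instrument — and every split support prime (`p ∤ v_ℓ(Δ)`) is `≡ 1 (mod p)` (the clause
`IsNonsplitTypeAt` / `IsEisensteinTypeAt … .1` of `Theorems/EisensteinPrimesKummerPartners`).
-/

noncomputable section

open scoped Classical

open WeierstrassCurve IsDedekindDomain NumberField Rat.HeightOneSpectrum Polynomial
  Literature.NumberTheory.EllipticCurves.LocalTorsionMult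

namespace Literature.NumberTheory.EllipticCurves

namespace TorsionMultCongruence

variable (W : WeierstrassCurve ℚ) [W.IsElliptic] [W.IsGloballyMinimal] (ℓ : ℕ) [hℓ : Fact ℓ.Prime]

/-! ### The place over `ℓ`; the index of `E₁(ℚ_ℓ)` -/

omit [W.IsGloballyMinimal] in
/-- The place of `𝓞 ℚ` over `ℓ` and the multiplicative-reduction predicates moved to it (copy of the
private lemma of `LocalTorsionMultiplicativeProofs`). [folklore] -/
private theorem exists_place_of_mult (hmult : W.HasMultiplicativeReductionAtPrime ℓ) :
    ∃ v : HeightOneSpectrum (𝓞 ℚ), (primesEquiv v : ℕ) = ℓ ∧ W.HasMultiplicativeReductionAt v ∧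
      (W.HasSplitMultiplicativeReductionAtPrime ℓ ↔ W.HasSplitMultiplicativeReductionAt v) := by
  set v : HeightOneSpectrum (𝓞 ℚ) := (primesEquiv (R := 𝓞 ℚ)).symm ⟨ℓ, hℓ.out⟩ with hvdef
  have hv : primesEquiv v = ⟨ℓ, hℓ.out⟩ := Equiv.apply_symm_apply _ _
  refine ⟨v, congrArg Subtype.val hv, ?_, ?_⟩
  · have key : ∀ q : Nat.Primes, primesEquiv v = q →
        (haveI := Fact.mk q.2; W.HasMultiplicativeReductionAtPrime (q : ℕ)) →
          W.HasMultiplicativeReductionAt v := by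
      rintro q rfl h
      exact
        (hasMultiplicativeReductionAtPrime_iff_hasMultiplicativeReductionAt_ringOfIntegers W v).mp h
    exact key ⟨ℓ, hℓ.out⟩ hv hmult
  · have key : ∀ q : Nat.Primes, primesEquiv v = q →
        ((haveI := Fact.mk q.2; W.HasSplitMultiplicativeReductionAtPrime (q : ℕ)) ↔
          W.HasSplitMultiplicativeReductionAt v) := by
      rintro q rfl
      exact hasSplitMultiplicativeReductionAtPrime_iff_hasSplitMultiplicativeReductionAt W v
    exact key ⟨ℓ, hℓ.out⟩ hv

omit [W.IsElliptic] in
/-- The number of points of Mathlib's reduction of `W/ℚ_ℓ` is the tree's `reductionPointCount W ℓ`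
(copy of the private lemma of `LocalTorsionMultiplicativeProofs`). [folklore] -/
private theorem natCard_point_reduction_baseChange_padic [(W.baseChange ℚ_[ℓ]).IsMinimal ℤ_[ℓ]] :
    Nat.card ((W.baseChange ℚ_[ℓ]).reduction ℤ_[ℓ]).toAffine.Point = reductionPointCount W ℓ := by
  have key : ∀ (X : WeierstrassCurve ℚ_[ℓ]) [X.IsMinimal ℤ_[ℓ]],
      ((integralModelInt W).map (Int.castRingHom ℤ_[ℓ])).baseChange ℚ_[ℓ] = X →
        Nat.card (X.reduction ℤ_[ℓ]).toAffine.Point = reductionPointCount W ℓ := by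
    intro X _ hX
    subst hX
    rw [reduction_baseChange_eq]
    exact natCard_point_padicModel_residue W ℓ
  exact key (W.baseChange ℚ_[ℓ]) (padicModel_baseChange W ℓ)

/-- **A `ℚ_ℓ`-point of prime order `p ≠ ℓ` forces `p ∣ c_ℓ · #Ẽ_ns(𝔽_ℓ)`** (any reduction type;
Silverman *AEC* VII.2.1 + VII.3.1): `m • P` lies in the kernel of reduction for
`m = [E(ℚ_ℓ) : E₁(ℚ_ℓ)] = c_ℓ · #Ẽ_ns(𝔽_ℓ)` (`index_formalFiltration`), and `E₁(ℚ_ℓ)` has no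
`p`-torsion for `p ≠ ℓ` (`eq_zero_of_nsmul_eq_zero_of_isInReductionKernel`), so `m • P = O` and the
order `p` of `P` divides `m`. [cite: SilvermanAEC2009, VII.2 Prop. 2.1 and VII.3 Prop. 3.1] -/
theorem dvd_localTamagawaNumber_mul_reductionPointCount_of_nsmul_eq_zero {p : ℕ} (hp : p.Prime)
    (hpl : p ≠ ℓ) (P : (W.baseChange ℚ_[ℓ]).toAffine.Point) (hP0 : P ≠ 0) (hpP : p • P = 0) :
    p ∣ (W.baseChange ℚ_[ℓ]).localTamagawaNumber ℤ_[ℓ] * reductionPointCount W ℓ := by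
  haveI : (W.baseChange ℚ_[ℓ]).IsMinimal ℤ_[ℓ] := isMinimal_map_padic_of_isGloballyMinimal W ℓ
  haveI : (W.baseChange ℚ_[ℓ]).IsElliptic := by rw [baseChange]; infer_instance
  set m : ℕ := ((W.baseChange ℚ_[ℓ]).formalFiltration 1).index with hm
  have hidx : m = (W.baseChange ℚ_[ℓ]).localTamagawaNumber ℤ_[ℓ] * reductionPointCount W ℓ := by
    rw [hm, index_formalFiltration (W.baseChange ℚ_[ℓ]) (le_refl 1), pow_zero, mul_one,
      natCard_point_reduction_baseChange_padic]
  have hmem : m • P ∈ (W.baseChange ℚ_[ℓ]).formalFiltration 1 := AddSubgroup.nsmul_index_mem _ P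
  have hker : (W.baseChange ℚ_[ℓ]).IsInReductionKernel (m • P) := hmem.1
  have hkill : p • (m • P) = 0 := by rw [smul_comm, hpP, nsmul_zero]
  have hlp : ¬ ℓ ∣ p := fun h ↦ hpl ((Nat.prime_dvd_prime_iff_eq hℓ.out hp).mp h).symm
  have hzero : m • P = 0 :=
    (W.baseChange ℚ_[ℓ]).eq_zero_of_nsmul_eq_zero_of_isInReductionKernel hlp hker hkill
  have hord : addOrderOf P = p :=
    (hp.eq_one_or_self_of_dvd _ (addOrderOf_dvd_iff_nsmul_eq_zero.mpr hpP)).resolve_left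
      (fun h1 ↦ hP0 (AddMonoid.addOrderOf_eq_one_iff.mp h1))
  rw [← hidx, ← hord]
  exact addOrderOf_dvd_iff_nsmul_eq_zero.mpr hzero

/-- **NON-split multiplicative `ℓ` and a `ℚ_ℓ`-point of odd prime order `p ≠ ℓ` ⟹ `p ∣ ℓ + 1`**
(`c_ℓ ∈ {1, 2}`, `#Ẽ_ns(𝔽_ℓ) = ℓ + 1`; Silverman *AEC* Thm. VII.6.1 / *ATAEC* IV.9.4 Step 2 and
Exercise 3.5). [cite: SilvermanAEC2009, Thm VII.6.1 and Exercise 3.5] [cite: SilvermanATAEC1994, IV.9.4 Step 2] -/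
theorem dvd_succ_of_nonsplit {p : ℕ} (hp : p.Prime) (hp2 : p ≠ 2) (hpl : p ≠ ℓ)
    (hmult : W.HasMultiplicativeReductionAtPrime ℓ) (hns : ¬ W.HasSplitMultiplicativeReductionAtPrime ℓ)
    (P : (W.baseChange ℚ_[ℓ]).toAffine.Point) (hP0 : P ≠ 0) (hpP : p • P = 0) : p ∣ ℓ + 1 := by
  have hdvd := dvd_localTamagawaNumber_mul_reductionPointCount_of_nsmul_eq_zero W ℓ hp hpl P hP0 hpP
  have hcount : reductionPointCount W ℓ = ℓ + 1 := (reductionPointCount_of_mult W ℓ hmult).2 hns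
  -- `p ∤ c_ℓ ∈ {1, 2}`
  obtain ⟨v, hvp, hmultv, hsplit⟩ := exists_place_of_mult W ℓ hmult
  haveI : Finite (IsLocalRing.ResidueField (v.adicCompletionIntegers ℚ)) :=
    HeightOneSpectrum.finite_residueField_adicCompletionIntegers ℚ v
  have hs : ¬ W.HasSplitMultiplicativeReductionAt v := fun h ↦ hns (hsplit.mpr h)
  have hc : ¬ p ∣ (W.baseChange ℚ_[ℓ]).localTamagawaNumber ℤ_[ℓ] := by
    rw [localTamagawaNumber_padic_eq_holds W v ℓ hvp,
      localTamagawaNumber_of_hasNonsplitMultiplicativeReductionAt_holds v W hmultv hs]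
    intro hd
    split_ifs at hd
    · exact hp2 ((Nat.prime_dvd_prime_iff_eq hp Nat.prime_two).mp hd)
    · exact hp.one_lt.ne' (Nat.dvd_one.mp hd)
  rw [hcount] at hdvd
  exact ((Nat.Prime.dvd_mul hp).mp hdvd).resolve_left hc

/-- **SPLIT multiplicative `ℓ` with `p ∤ v_ℓ(Δ_min)` and a `ℚ_ℓ`-point of prime order `p ≠ ℓ` ⟹
`p ∣ ℓ − 1`** (`c_ℓ = v_ℓ(Δ_min)`, `#Ẽ_ns(𝔽_ℓ) = ℓ − 1`; Silverman *AEC* Thm. VII.6.1 and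
Exercise 3.5). [cite: SilvermanAEC2009, Thm VII.6.1 and Exercise 3.5] -/
theorem dvd_pred_of_split {p : ℕ} (hp : p.Prime) (hpl : p ≠ ℓ)
    (hsp : W.HasSplitMultiplicativeReductionAtPrime ℓ)
    (hv : ¬ p ∣ padicValInt ℓ W.minimalDiscriminantInt)
    (P : (W.baseChange ℚ_[ℓ]).toAffine.Point) (hP0 : P ≠ 0) (hpP : p • P = 0) : p ∣ ℓ - 1 := by
  have hmult : W.HasMultiplicativeReductionAtPrime ℓ := hsp.hasMultiplicativeReductionAtPrime
  have hdvd := dvd_localTamagawaNumber_mul_reductionPointCount_of_nsmul_eq_zero W ℓ hp hpl P hP0 hpP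
  have hcount : reductionPointCount W ℓ + 1 = ℓ := (reductionPointCount_of_mult W ℓ hmult).1 hsp
  obtain ⟨v, hvp, -, hsplit⟩ := exists_place_of_mult W ℓ hmult
  haveI : Finite (IsLocalRing.ResidueField (v.adicCompletionIntegers ℚ)) :=
    HeightOneSpectrum.finite_residueField_adicCompletionIntegers ℚ v
  have hc : ¬ p ∣ (W.baseChange ℚ_[ℓ]).localTamagawaNumber ℤ_[ℓ] := by
    rw [localTamagawaNumber_padic_eq_holds W v ℓ hvp,
      localTamagawaNumber_eq_ordMinimalDiscriminant_of_hasSplitMultiplicativeReductionAt v W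
        (hsplit.mp hsp), ordMinimalDiscriminant_eq_padicValInt W v hvp]
    exact hv
  have hl : reductionPointCount W ℓ = ℓ - 1 := by omega
  rw [hl] at hdvd
  exact ((Nat.Prime.dvd_mul hp).mp hdvd).resolve_left hc

/-! ### From a rational point of order `p`, and from `p ∣ #W(ℚ)_tors` -/

omit [W.IsElliptic] [W.IsGloballyMinimal] in
/-- A rational point of prime order `p` gives a `ℚ_ℓ`-point of order `p` (`W(ℚ) ↪ W(ℚ_ℓ)`).
[cite: SilvermanAEC2009, VII.3 Prop. 3.1] -/
theorem exists_padicPoint_of_rat {p : ℕ} (P : W.toAffine.Point) (hP0 : P ≠ 0) (hpP : p • P = 0) :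
    ∃ Q : (W.baseChange ℚ_[ℓ]).toAffine.Point, Q ≠ 0 ∧ p • Q = 0 := by
  set ι : W.toAffine.Point →+ (W.baseChange ℚ_[ℓ]).toAffine.Point :=
    WeierstrassCurve.Affine.Point.map (W' := W.toAffine) (S := ℚ) (Algebra.ofId ℚ ℚ_[ℓ]) with hι
  have hinj : Function.Injective ι :=
    WeierstrassCurve.Affine.Point.map_injective (W' := W.toAffine) (f := Algebra.ofId ℚ ℚ_[ℓ])
  refine ⟨ι P, fun h ↦ hP0 (hinj (by rw [h, map_zero])), ?_⟩
  rw [← map_nsmul, hpP, map_zero]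

omit [W.IsGloballyMinimal] hℓ in
/-- `p ∣ #W(ℚ)_tors` for a prime `p` gives a rational point of order `p` (Cauchy; the torsion
subgroup of `W(ℚ)` is finite). [cite: SilvermanAEC2009, VII.3 Prop. 3.1] -/
theorem exists_point_of_dvd_torsionOrder {p : ℕ} (hp : p.Prime) (hdvd : p ∣ W.torsionOrder) :
    ∃ P : W.toAffine.Point, P ≠ 0 ∧ p • P = 0 := by
  haveI : Fact p.Prime := ⟨hp⟩
  haveI : Finite (AddCommGroup.torsion W.toAffine.Point) := finite_torsion_rat W
  have hcard : p ∣ Nat.card (AddCommGroup.torsion W.toAffine.Point) := by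
    rw [← torsionOrder_eq_natCard_torsion]; exact hdvd
  obtain ⟨x, hx⟩ := exists_prime_addOrderOf_dvd_card' (G := AddCommGroup.torsion W.toAffine.Point) p hcard
  refine ⟨(x : W.toAffine.Point), ?_, ?_⟩
  · intro h0
    have : addOrderOf x = 1 := by
      rw [AddMonoid.addOrderOf_eq_one_iff]
      exact Subtype.ext h0
    rw [hx] at this
    exact hp.one_lt.ne' this
  · have h := addOrderOf_nsmul_eq_zero x
    rw [hx] at h
    have := congrArg Subtype.val h
    simpa using this

/-- **NON-split multiplicative `ℓ ≠ p` on a curve with `p ∣ #W(ℚ)_tors`, `p` an odd prime ⟹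
`p ∣ ℓ + 1`.** [cite: SilvermanAEC2009, Thm VII.6.1, VII.3 Prop. 3.1 and Exercise 3.5] -/
theorem dvd_succ_of_nonsplit_of_dvd_torsionOrder {p : ℕ} (hp : p.Prime) (hp2 : p ≠ 2) (hpl : p ≠ ℓ)
    (htors : p ∣ W.torsionOrder) (hmult : W.HasMultiplicativeReductionAtPrime ℓ)
    (hns : ¬ W.HasSplitMultiplicativeReductionAtPrime ℓ) : p ∣ ℓ + 1 := by
  obtain ⟨P, hP0, hpP⟩ := exists_point_of_dvd_torsionOrder W hp htors
  obtain ⟨Q, hQ0, hpQ⟩ := exists_padicPoint_of_rat W ℓ P hP0 hpP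
  exact dvd_succ_of_nonsplit W ℓ hp hp2 hpl hmult hns Q hQ0 hpQ

/-- **SPLIT multiplicative `ℓ ≠ p` with `p ∤ v_ℓ(Δ_min)` on a curve with `p ∣ #W(ℚ)_tors` ⟹
`p ∣ ℓ − 1`.** [cite: SilvermanAEC2009, Thm VII.6.1, VII.3 Prop. 3.1 and Exercise 3.5] -/
theorem dvd_pred_of_split_of_dvd_torsionOrder {p : ℕ} (hp : p.Prime) (hpl : p ≠ ℓ)
    (htors : p ∣ W.torsionOrder) (hsp : W.HasSplitMultiplicativeReductionAtPrime ℓ)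
    (hv : ¬ p ∣ padicValInt ℓ W.minimalDiscriminantInt) : p ∣ ℓ - 1 := by
  obtain ⟨P, hP0, hpP⟩ := exists_point_of_dvd_torsionOrder W hp htors
  obtain ⟨Q, hQ0, hpQ⟩ := exists_padicPoint_of_rat W ℓ P hP0 hpP
  exact dvd_pred_of_split W ℓ hp hpl hsp hv Q hQ0 hpQ

/-- **`ZMod` spelling, non-split case: `(ℓ : ZMod p) = −1`** for a non-split multiplicative `ℓ ≠ p`
of a curve with a rational point of odd prime order `p`. [cite: SilvermanAEC2009, Thm VII.6.1 and Exercise 3.5] -/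
theorem cast_eq_neg_one_of_nonsplit_of_dvd_torsionOrder {p : ℕ} (hp : p.Prime) (hp2 : p ≠ 2)
    (hpl : p ≠ ℓ) (htors : p ∣ W.torsionOrder) (hmult : W.HasMultiplicativeReductionAtPrime ℓ)
    (hns : ¬ W.HasSplitMultiplicativeReductionAtPrime ℓ) : (ℓ : ZMod p) = -1 := by
  have h := dvd_succ_of_nonsplit_of_dvd_torsionOrder W ℓ hp hp2 hpl htors hmult hns
  have h' : ((ℓ + 1 : ℕ) : ZMod p) = 0 := (ZMod.natCast_eq_zero_iff (ℓ + 1) p).mpr h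
  rw [Nat.cast_add, Nat.cast_one] at h'
  exact eq_neg_of_add_eq_zero_left h'

/-- **`ZMod` spelling, split case: `(ℓ : ZMod p) = 1`** for a split multiplicative `ℓ ≠ p` with
`p ∤ v_ℓ(Δ_min)` of a curve with a rational point of prime order `p`.
[cite: SilvermanAEC2009, Thm VII.6.1 and Exercise 3.5] -/
theorem cast_eq_one_of_split_of_dvd_torsionOrder {p : ℕ} (hp : p.Prime) (hpl : p ≠ ℓ)
    (htors : p ∣ W.torsionOrder) (hsp : W.HasSplitMultiplicativeReductionAtPrime ℓ)
    (hv : ¬ p ∣ padicValInt ℓ W.minimalDiscriminantInt) : (ℓ : ZMod p) = 1 := by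
  have h := dvd_pred_of_split_of_dvd_torsionOrder W ℓ hp hpl htors hsp hv
  have hl1 : 1 ≤ ℓ := hℓ.out.one_lt.le
  have h' : ((ℓ - 1 : ℕ) : ZMod p) = 0 := (ZMod.natCast_eq_zero_iff (ℓ - 1) p).mpr h
  rw [Nat.cast_sub hl1, Nat.cast_one] at h'
  exact (sub_eq_zero.mp h')

end TorsionMultCongruence

end Literature.NumberTheory.EllipticCurves

end
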